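import Literature.LinearAlgebra.Matrix.ExtremalChannels
import HarnessLib

/-!
# Isometric freedom of Kraus representations: if `Φ(A) = Σ_i V_i^* A V_i` with `{V_i}` linearly independent, then
# `Φ(A) = Σ_p W_p^* A W_p` iff `W_p = Σ_i μ_pi V_i` for an isometry `(μ_pi)`, unitary when `{W_p}` is also linearly
# independent, and then `ℓ' = ℓ` (Choi, *Completely positive linear maps on complex matrices*, LAA 10 (1975), Remark 4)

Hodge foundations lane (`lit-hodgefound`, prover p24 gen 65 #11; matrix-analysis series, sequel of
`ChoiTheoremCompletelyPositiveMaps.lean` (#1: the 'if' part `kraus_eq_of_isometry`), `ChoiRankKrausRepresentations.lean`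
(#5: `J(Φ) = R^*R`) and `ExtremalChannels.lean` (#9: `RR^* ≻ 0`, `x ↦ xR` injective for an independent family)).
THEOREMS ONLY: no definition, no named fact, net debt 0.  Everything over `ℂ`.

## Source, VERBATIM — M.-D. Choi, Linear Algebra Appl. 10 (1975) 285–290 [Choi1975], p. 287 (held
`paper:doi-10-1016-0024-3795-75-90075-0`, p0003; OCR, brackets restore the symbols)

«REMARK 4. … `{V_i}` is not uniquely determined … in the following sense: Let `{V_i}_i` be a linearly independent
set [and] `Φ(A) = Σ_i V_i^* A V_i`; then `Φ` has the expression `Φ(A) = Σ_p W_p^* A W_p` iff there exists an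
isometry, an `ℓ' × ℓ` matrix `(μ_pi)_pi`, such that `W_p = Σ_i μ_pi V_i` for all `p`. If `{W_p}_p` is also a
linearly independent set, then `ℓ' = ℓ`, and `(μ_pi)_pi` is unitary.
Proof. The 'if' part follows by direct computation. We proceed to prove the 'only if' part. Denote by `w_p` the
display of `W_p` as a `1 × nm` matrix. As in the proof of Theorem 1, `Σ_p w_p^* w_p = (Φ(E_jk))_jk = Σ_i u_i^*u_i`.
Thus `w_p^*` belongs to `sp{u_i^*}_i`, the linear span of `{u_i^*}_i`; namely, there exists `(μ_pi)` such that
`w_p^* = Σ_i μ̄_pi u_i^*`. It follows that `W_p = Σ_i μ_pi V_i`. Since `{u_i^*}_i` is a linearly independent set,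
`{u_i^*u_j}_ij` is also a linearly independent set … From `Σ_i u_i^*u_i = Σ_p w_p^*w_p = Σ_{p,i,j} μ̄_pi μ_pj u_i^*u_j`
we obtain `Σ_p μ̄_pi μ_pj = δ_ij`. Hence `(μ_pi)` is an isometry. In case that `{W_p}_p` is also a linearly
independent set, from `sp{u_i^*}_i = sp{w_p^*}_p`, we derive that `ℓ = ℓ'` and `(μ_pi)` is unitary.»
(The general unitary freedom without independence assumptions — families of equal length related by a unitary —
is [Watrous2018, Corollary 2.23]; it needs the unitary equivalence of purifications and is NOT formalized here.)

## Dictionary (no definitions are introduced; as in #5/#9)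

* `u_i` = the `i`-th ROW of `R_V = (of fun s x => V s x.1 x.2 : Matrix σ (n × m) ℂ)` (the «display of `V_i` as a
  `1 × nm` matrix»); `Σ_i u_i^*u_i = R_V^* R_V = (Φ(E_jk))_jk` (#5 `choi_kraus₂`).
* The isometry is explicit: `μ = R_W R_V^* (R_V R_V^*)^{-1}` (coefficients of `w_p` in the basis `{u_i}`, via the
  Gram inverse; Choi only asserts existence).

## What is formalized (all PROVED)

`conjTranspose_rows_mul_rows_eq` (equal maps ⇒ `R_W^*R_W = R_V^*R_V`), `mul_proj_eq_of_conjTranspose_mul_self_eq`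
(`w_p ∈ sp{u_i}`: `SΠ = S` for the projection `Π = R^*(RR^*)^{-1}R` when `S^*S = R^*R`), **`remark_4_only_if`** (isometry `μ` with
`W_p = Σ_i μ_pi V_i`), `remark_4_iff` (with #1's 'if' part), **`remark_4_unitary`** (both families independent ⇒
`μ` unitary), **`card_eq_of_kraus_linearIndependent`** (`ℓ' = ℓ`).
-/

open Matrix
open scoped ComplexOrder MatrixOrder

namespace Literature.LinearAlgebra.Matrix.KrausFamiliesIsometricFreedom

open Literature.LinearAlgebra.Matrix.ChoiTheoremCompletelyPositiveMaps (kraus_eq_of_isometry)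
open Literature.LinearAlgebra.Matrix.ChoiRankKrausRepresentations (choi_kraus₂)
open Literature.LinearAlgebra.Matrix.ExtremalChannels (posDef_rows_mul_conjTranspose vecMul_rows_injective)

variable {n m σ τ : Type*} [Fintype n] [Fintype m] [Fintype σ] [Fintype τ] [DecidableEq n] [DecidableEq m] [DecidableEq σ]

omit [Fintype m] [DecidableEq m] [DecidableEq σ] in
/-- **«`Σ_p w_p^* w_p = (Φ(E_jk))_jk = Σ_i u_i^* u_i`»**: two Kraus families of the same map have the same Choi
matrix, `R_W^* R_W = R_V^* R_V`. [cite: Choi1975, Remark 4 (proof)] -/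
theorem conjTranspose_rows_mul_rows_eq (V : σ → Matrix n m ℂ) (W : τ → Matrix n m ℂ)
    (hVW : ∀ A : Matrix n n ℂ, ∑ t, (W t)ᴴ * A * W t = ∑ s, (V s)ᴴ * A * V s) :
    (of fun t (x : n × m) => W t x.1 x.2 : Matrix τ (n × m) ℂ)ᴴ * (of fun t (x : n × m) => W t x.1 x.2) =
      (of fun s (x : n × m) => V s x.1 x.2 : Matrix σ (n × m) ℂ)ᴴ * (of fun s (x : n × m) => V s x.1 x.2) := by
  have h : (fun j k => ∑ t, (W t)ᴴ * (single j k (1 : ℂ) : Matrix n n ℂ) * W t) =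
      fun j k => ∑ s, (V s)ᴴ * (single j k (1 : ℂ) : Matrix n n ℂ) * V s := by
    funext j k
    exact hVW _
  rw [← choi_kraus₂ W W, ← choi_kraus₂ V V]
  exact congrArg (fun f : n → n → Matrix m m ℂ => comp n n m m ℂ (of f)) h

omit [Fintype n] [Fintype m] [DecidableEq n] [DecidableEq m] in
/-- **«`w_p^*` belongs to `sp{u_i^*}_i`»**: with `Π = R^*(RR^*)^{-1}R` the orthogonal projection onto the row space
of `R` (rows `u_i`, `RR^* ≻ 0`), `SΠ = S` whenever `S^*S = R^*R` (indeed `(S(𝟙 − Π))^*(S(𝟙 − Π)) =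
(𝟙 − Π)R^*R(𝟙 − Π) = 0`). [cite: Choi1975, Remark 4 (proof)] -/
theorem mul_proj_eq_of_conjTranspose_mul_self_eq {ι : Type*} [Fintype ι] [DecidableEq ι] {R : Matrix σ ι ℂ}
    {S : Matrix τ ι ℂ} (hGpd : (R * Rᴴ).PosDef) (hG : Sᴴ * S = Rᴴ * R) : S * (Rᴴ * (R * Rᴴ)⁻¹ * R) = S := by
  have hd : IsUnit (R * Rᴴ).det := (isUnit_iff_isUnit_det _).mp hGpd.isUnit
  have hGi : (R * Rᴴ)⁻¹ᴴ = (R * Rᴴ)⁻¹ := hGpd.inv.1.eq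
  -- `P (𝟙 − Π) = 0` for `P = R^*R`
  have hP : Rᴴ * R * (1 - Rᴴ * (R * Rᴴ)⁻¹ * R) = 0 := by
    rw [Matrix.mul_sub, Matrix.mul_one]
    have : Rᴴ * R * (Rᴴ * (R * Rᴴ)⁻¹ * R) = Rᴴ * ((R * Rᴴ) * (R * Rᴴ)⁻¹) * R := by
      simp only [Matrix.mul_assoc]
    rw [this, mul_nonsing_inv _ hd, Matrix.mul_one, sub_self]
  -- `X^*X = 0` for `X = S(𝟙 − Π)`, hence `X = 0`
  have hPih : (1 - Rᴴ * (R * Rᴴ)⁻¹ * R)ᴴ = 1 - Rᴴ * (R * Rᴴ)⁻¹ * R := by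
    rw [conjTranspose_sub, conjTranspose_one, conjTranspose_mul, conjTranspose_mul, conjTranspose_conjTranspose, hGi,
      ← Matrix.mul_assoc]
  have hX : (S * (1 - Rᴴ * (R * Rᴴ)⁻¹ * R))ᴴ * (S * (1 - Rᴴ * (R * Rᴴ)⁻¹ * R)) = 0 := by
    rw [conjTranspose_mul, hPih, Matrix.mul_assoc, ← Matrix.mul_assoc Sᴴ, hG, ← Matrix.mul_assoc, Matrix.mul_assoc,
      hP, Matrix.mul_zero]
  have hX0 := conjTranspose_mul_self_eq_zero.mp hX
  rw [Matrix.mul_sub, Matrix.mul_one, sub_eq_zero] at hX0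
  exact hX0.symm

/-- **REMARK 4, 'only if': if `{V_i}` is linearly independent and `Σ_p W_p^* A W_p = Σ_i V_i^* A V_i` for all `A`,
then `W_p = Σ_i μ_pi V_i` for an isometry `(μ_pi)` (`μ^*μ = 𝟙`)** — explicitly `μ = R_W R_V^*(R_VR_V^*)^{-1}`.
[cite: Choi1975, Remark 4] -/
theorem remark_4_only_if (V : σ → Matrix n m ℂ) (W : τ → Matrix n m ℂ) (hV : LinearIndependent ℂ V)
    (hVW : ∀ A : Matrix n n ℂ, ∑ t, (W t)ᴴ * A * W t = ∑ s, (V s)ᴴ * A * V s) :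
    ∃ μ : Matrix τ σ ℂ, μᴴ * μ = 1 ∧ ∀ t, W t = ∑ s, μ t s • V s := by
  set R := (of fun s (x : n × m) => V s x.1 x.2 : Matrix σ (n × m) ℂ) with hR
  set S := (of fun t (x : n × m) => W t x.1 x.2 : Matrix τ (n × m) ℂ) with hS
  have hG : Sᴴ * S = Rᴴ * R := conjTranspose_rows_mul_rows_eq V W hVW
  have hGpd : (R * Rᴴ).PosDef := posDef_rows_mul_conjTranspose V hV
  have hd : IsUnit (R * Rᴴ).det := (isUnit_iff_isUnit_det _).mp hGpd.isUnit
  have hGi : (R * Rᴴ)⁻¹ᴴ = (R * Rᴴ)⁻¹ := hGpd.inv.1.eq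
  have hSR : S * Rᴴ * (R * Rᴴ)⁻¹ * R = S := by
    have h := mul_proj_eq_of_conjTranspose_mul_self_eq hGpd hG
    simpa only [Matrix.mul_assoc] using h
  refine ⟨S * Rᴴ * (R * Rᴴ)⁻¹, ?_, fun t => ?_⟩
  · -- `μ^*μ = G⁻¹ R (S^*S) R^* G⁻¹ = G⁻¹ G G G⁻¹ = 𝟙`
    rw [conjTranspose_mul, conjTranspose_mul, conjTranspose_conjTranspose, hGi]
    calc (R * Rᴴ)⁻¹ * (R * Sᴴ) * (S * Rᴴ * (R * Rᴴ)⁻¹)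
        = (R * Rᴴ)⁻¹ * (R * (Sᴴ * S) * Rᴴ) * (R * Rᴴ)⁻¹ := by simp only [Matrix.mul_assoc]
      _ = (R * Rᴴ)⁻¹ * (R * Rᴴ) * ((R * Rᴴ) * (R * Rᴴ)⁻¹) := by rw [hG]; simp only [Matrix.mul_assoc]
      _ = 1 := by rw [nonsing_inv_mul _ hd, mul_nonsing_inv _ hd, Matrix.mul_one]
  · -- read row `t` of `S = μ R`
    ext a b
    have h := congr_fun (congr_fun hSR t) (a, b)
    rw [Matrix.mul_apply] at h
    simp only [Matrix.sum_apply, Matrix.smul_apply, smul_eq_mul]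
    exact h.symm

/-- **REMARK 4 (iff)**: for `{V_i}` linearly independent, `Σ_p W_p^* A W_p = Σ_i V_i^* A V_i` for all `A` iff
`W_p = Σ_i μ_pi V_i` for some isometry `(μ_pi)` (the 'if' part is #1's `kraus_eq_of_isometry`). [cite: Choi1975, Remark 4] -/
theorem remark_4_iff (V : σ → Matrix n m ℂ) (W : τ → Matrix n m ℂ) (hV : LinearIndependent ℂ V) :
    (∀ A : Matrix n n ℂ, ∑ t, (W t)ᴴ * A * W t = ∑ s, (V s)ᴴ * A * V s) ↔
      ∃ μ : Matrix τ σ ℂ, μᴴ * μ = 1 ∧ ∀ t, W t = ∑ s, μ t s • V s :=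
  ⟨remark_4_only_if V W hV, fun ⟨μ, hμ, hW⟩ A => kraus_eq_of_isometry V W μ hμ hW A⟩

/-- **REMARK 4, unitary case: if both `{V_i}` and `{W_p}` are linearly independent Kraus families of the same map,
the isometry `(μ_pi)` is unitary.** [cite: Choi1975, Remark 4] -/
theorem remark_4_unitary [DecidableEq τ] (V : σ → Matrix n m ℂ) (W : τ → Matrix n m ℂ) (hV : LinearIndependent ℂ V)
    (hW : LinearIndependent ℂ W) (hVW : ∀ A : Matrix n n ℂ, ∑ t, (W t)ᴴ * A * W t = ∑ s, (V s)ᴴ * A * V s) :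
    ∃ μ : Matrix τ σ ℂ, μᴴ * μ = 1 ∧ μ * μᴴ = 1 ∧ ∀ t, W t = ∑ s, μ t s • V s := by
  obtain ⟨μ, hμ, hWμ⟩ := remark_4_only_if V W hV hVW
  obtain ⟨ν, hν, hVν⟩ := remark_4_only_if W V hW fun A => (hVW A).symm
  set R := (of fun s (x : n × m) => V s x.1 x.2 : Matrix σ (n × m) ℂ) with hR
  set S := (of fun t (x : n × m) => W t x.1 x.2 : Matrix τ (n × m) ℂ) with hS
  have hSμ : S = μ * R := by
    ext t x
    rw [hS, of_apply, hWμ t, Matrix.sum_apply, Matrix.mul_apply]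
    refine Finset.sum_congr rfl fun s _ => ?_
    rw [Matrix.smul_apply, smul_eq_mul, hR, of_apply]
  have hRν : R = ν * S := by
    ext s x
    rw [hR, of_apply, hVν s, Matrix.sum_apply, Matrix.mul_apply]
    refine Finset.sum_congr rfl fun t _ => ?_
    rw [Matrix.smul_apply, smul_eq_mul, hS, of_apply]
  -- `(μν − 𝟙) S = 0` and `x ↦ xS` injective ⇒ `μν = 𝟙`
  have hμν : μ * ν = 1 := by
    have h0 : (μ * ν - 1) * S = 0 := by
      rw [Matrix.sub_mul, Matrix.one_mul, Matrix.mul_assoc, ← hRν, ← hSμ, sub_self]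
    have hinj := vecMul_rows_injective W hW
    have hrow : ∀ t, (μ * ν - 1 : Matrix τ τ ℂ) t = 0 := fun t => hinj (by
      change ((μ * ν - 1 : Matrix τ τ ℂ) t) ᵥ* S = (0 : τ → ℂ) ᵥ* S
      rw [zero_vecMul]
      funext x
      have hx := congr_fun (congr_fun h0 t) x
      rw [Matrix.mul_apply, Matrix.zero_apply] at hx
      simp only [vecMul, dotProduct, Pi.zero_apply]
      exact hx)
    rw [← sub_eq_zero]
    ext t s
    exact congr_fun (hrow t) s
  refine ⟨μ, hμ, ?_, hWμ⟩
  -- `μ^* = μ^*(μν) = ν`, so `μμ^* = μν = 𝟙`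
  have hμs : μᴴ = ν := by
    calc μᴴ = μᴴ * (μ * ν) := by rw [hμν, Matrix.mul_one]
      _ = ν := by rw [← Matrix.mul_assoc, hμ, Matrix.one_mul]
  rw [hμs, hμν]

/-- **REMARK 4, «then `ℓ' = ℓ`»: two linearly independent Kraus families of the same map have the same length.**
[cite: Choi1975, Remark 4] -/
theorem card_eq_of_kraus_linearIndependent [DecidableEq τ] (V : σ → Matrix n m ℂ) (W : τ → Matrix n m ℂ)
    (hV : LinearIndependent ℂ V) (hW : LinearIndependent ℂ W)
    (hVW : ∀ A : Matrix n n ℂ, ∑ t, (W t)ᴴ * A * W t = ∑ s, (V s)ᴴ * A * V s) : Fintype.card τ = Fintype.card σ := by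
  obtain ⟨μ, hμ, hμ', -⟩ := remark_4_unitary V W hV hW hVW
  have h := Matrix.trace_mul_comm μᴴ μ
  rw [hμ, hμ', trace_one, trace_one] at h
  exact_mod_cast h.symm

end Literature.LinearAlgebra.Matrix.KrausFamiliesIsometricFreedom
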